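import Summits.AtomisticToContinuum.Crystallization.Theses.PalmUnimodularRigidity
import Summits.AtomisticToContinuum.Crystallization.Theorems.MinimiserShells.Negative.LoadBearing
import Summits.AtomisticToContinuum.Crystallization.Theorems.MinimiserShells.Negative.Rootedness
import Summits.AtomisticToContinuum.Crystallization.Theorems.ChargedEnergyGap.Negative.Periodisation
import Summits.AtomisticToContinuum.Crystallization.Theorems.PalmUnimodularRigidityMinimiserShellsDeepBadPricingOfShellNoBoundary

/-!
# The periodic shell gap gives the qualitative no-boundary shell gap (stub S13, reshape r5)

Stub `stub_qualShellNoBoundary_of_periodicShellGap` (S13) of line `equilibrium-in-law-surgery` (reshape r5) of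
crux `MinimiserShells` (stmt-AtomisticToContinuum-9225, route `PalmUnimodularRigidity`).

If the PERIODIC shell gap holds — for every threshold `t > 0` some `κ > 0` such that every periodic
configuration `Q` of `ℝ³` with at least `t · #motif` motif sites badly shelled in the infinite point set
`Q.points` has `e* + κ ≤ e(Q)` — then the QUALITATIVE particle-level no-boundary shell gap holds with the
SAME `κ` for each `t`: every finite injective configuration `y : Fin N → ℝ³` with at least `t · N`
badly-shelled sites has `N · (e* + κ) ≤ 𝓔_N(y)`.

Proof.  `N = 0` is `0 ≤ 0`.  For `N ≥ 1` periodise `y` with the cubic lattice of period `2Σ‖yᵢ‖ + 2`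
(`ChargedEnergyGapNegative.periodise`, motif `{yᵢ}` of cardinality `N`).  Points of the periodisation
other than the `yⱼ` are at distance `≥ 2` from every `yᵢ` (`two_le_dist_of_mem_points`), so the points
within `3/2` of `yᵢ` are among the `yⱼ`; by locality of the shell predicate
(`ShellNoBoundary.goodShell_count_restrict_image_sub_congr`, `R₀ = 3/2 ≥ 5/4`) the motif site `yᵢ` is badly
shelled in the infinite point set iff index `i` is badly shelled in `y`.  Hence the badly-shelled indices of
`y` inject into the badly-shelled motif sites, `#bad motif ≥ #bad(y) ≥ t · N = t · #motif`, and
`e* + κ ≤ e(Q) ≤ 𝓔_N(y) / N` (`energyPerParticle_periodise_le`: `V_LJ ≤ 0` beyond distance `1`).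
-/

noncomputable section

open MeasureTheory
open scoped ENNReal BigOperators Classical

namespace Summit.AtomisticToContinuum.Crystallization.Theorems.PalmUnimodularRigidityMinimiserShells.PeriodicShellGap

open Literature.MathematicalPhysics.StatisticalMechanics (lennardJones interactionEnergy PeriodicConfiguration)
open Summit.AtomisticToContinuum.Crystallization.Theorems.MinimiserShells.Negative.LoadBearing (eStar GoodShell)
open Summit.AtomisticToContinuum.Crystallization.Theorems.MinimiserShells.Negative.Rootedness (E3)
open Summit.AtomisticToContinuum.Crystallization.Theorems.PalmUnimodularRigidityMinimiserShells.ShellNoBoundary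
  (goodShell_count_restrict_image_sub_congr count_restrict_image_sub_singleton_ne_zero_iff)
open Summit.AtomisticToContinuum.Crystallization.Theorems.ChargedEnergyGapNegative
  (periodise periodUnit motif_periodise two_le_dist_of_mem_points energyPerParticle_periodise_le)

variable {N : ℕ}

/-! ## Shells of the motif sites of the periodisation -/

/-- The `yᵢ` are motif points of the periodisation `y + (2Σ‖yᵢ‖ + 2)ℤ³`. -/
theorem mem_motif_periodise (y : Fin N → E3) (hN : 0 < N) (i : Fin N) :
    y i ∈ (periodise y (periodUnit y) le_rfl hN).motif := by
  rw [motif_periodise]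
  exact Finset.mem_image_of_mem y (Finset.mem_univ i)

/-- The finite configuration sits inside its periodisation: `range y ⊆ Q.points`. -/
theorem range_subset_points_periodise (y : Fin N → E3) (hN : 0 < N) :
    Set.range y ⊆ (periodise y (periodUnit y) le_rfl hN).points := by
  rintro _ ⟨i, rfl⟩
  exact (periodise y (periodUnit y) le_rfl hN).mem_points_of_mem_motif (mem_motif_periodise y hN i)

/-- **The `yᵢ` are `3/2`-deep in `range y`**: a point of the periodisation within distance `3/2` of
some `yᵢ` is one of the `yⱼ` (the other points are at distance `≥ 2`, `two_le_dist_of_mem_points`). -/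
theorem points_periodise_inter_closedBall_subset_range (y : Fin N → E3) (hN : 0 < N) (i : Fin N) :
    (periodise y (periodUnit y) le_rfl hN).points ∩ Metric.closedBall (y i) (3 / 2) ⊆ Set.range y := by
  rintro p ⟨hp, hball⟩
  by_contra hnot
  have hfar : ∀ j, p ≠ y j := fun j hj => hnot ⟨j, hj.symm⟩
  have h2 := two_le_dist_of_mem_points y (periodUnit y) le_rfl hN i hp hfar
  rw [Metric.mem_closedBall, dist_comm] at hball
  linarith

/-- **Motif shells read in the periodic point set are the shells of `y`.**  The motif site `yᵢ` is
well shelled in the infinite point set of the periodisation iff index `i` is well shelled in the finite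
configuration `y` (locality of `GoodShell`, `goodShell_count_restrict_image_sub_congr` with `R₀ = 3/2`). -/
theorem goodShell_periodise_iff (y : Fin N → E3) (hN : 0 < N) (i : Fin N) :
    GoodShell ((Measure.count : Measure E3).restrict
        ((fun z => z - y i) '' (periodise y (periodUnit y) le_rfl hN).points)) ↔
      GoodShell ((Measure.count : Measure E3).restrict ((fun z => z - y i) '' Set.range y)) :=
  goodShell_count_restrict_image_sub_congr (range_subset_points_periodise y hN)
    (by norm_num : (5 : ℝ) / 4 ≤ 3 / 2) (points_periodise_inter_closedBall_subset_range y hN i)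

/-- **Badly-shelled indices inject into badly-shelled motif sites.**  For injective `y`, the number of
indices `i` badly shelled in `y` is at most the number of motif sites of the periodisation badly shelled
in its infinite point set (`i ↦ yᵢ`, `goodShell_periodise_iff`). -/
theorem natCard_bad_le_natCard_badMotif_periodise {y : Fin N → E3} (hy : Function.Injective y)
    (hN : 0 < N) :
    Nat.card {i : Fin N // ¬ GoodShell
        ((Measure.count : Measure E3).restrict ((fun z => z - y i) '' Set.range y))} ≤
      Nat.card {x : (periodise y (periodUnit y) le_rfl hN).motif // ¬ GoodShell
        ((Measure.count : Measure E3).restrict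
          ((fun z => z - (x : E3)) '' (periodise y (periodUnit y) le_rfl hN).points))} := by
  refine Nat.card_le_card_of_injective
    (fun i => (⟨⟨y i.1, mem_motif_periodise y hN i.1⟩,
      fun h => i.2 ((goodShell_periodise_iff y hN i.1).1 h)⟩ :
        {x : (periodise y (periodUnit y) le_rfl hN).motif // ¬ GoodShell
          ((Measure.count : Measure E3).restrict
            ((fun z => z - (x : E3)) '' (periodise y (periodUnit y) le_rfl hN).points))})) ?_
  intro a b hab
  have h : y a.1 = y b.1 :=
    congrArg (fun z : {x : (periodise y (periodUnit y) le_rfl hN).motif // ¬ GoodShell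
        ((Measure.count : Measure E3).restrict
          ((fun z => z - (x : E3)) '' (periodise y (periodUnit y) le_rfl hN).points))} =>
      ((z.1 : (periodise y (periodUnit y) le_rfl hN).motif) : E3)) hab
  exact Subtype.ext (hy h)

/-! ## The stub -/

/-- **Stub `stub_qualShellNoBoundary_of_periodicShellGap` (S13) of line `equilibrium-in-law-surgery`.**
The periodic shell gap (periodic configurations with at least `t · #motif` motif sites badly shelled in
`Q.points` have `e* + κ ≤ e(Q)`) implies the qualitative particle-level no-boundary shell gap (finite
injective configurations with at least `t · N` badly-shelled sites have `N · (e* + κ) ≤ 𝓔_N`), with the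
same `κ` for each `t`: periodise `y` with the cubic lattice of period `2Σ‖yᵢ‖ + 2`; motif shells read in
the periodic point set are the shells of `y` (`goodShell_periodise_iff`), so
`#bad motif ≥ #bad(y) ≥ t · N = t · #motif`, and `e(Q) ≤ 𝓔_N(y) / N` (`energyPerParticle_periodise_le`). -/
theorem stub_qualShellNoBoundary_of_periodicShellGap :
    (∀ t : ℝ, 0 < t → ∃ κ : ℝ, 0 < κ ∧
      ∀ Q : Literature.MathematicalPhysics.StatisticalMechanics.PeriodicConfiguration 3,
        t * (Q.motif.card : ℝ) ≤ (Nat.card {x : Q.motif // ¬ GoodShell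
            ((Measure.count : Measure (EuclideanSpace ℝ (Fin 3))).restrict
              ((fun z => z - (x : EuclideanSpace ℝ (Fin 3))) '' Q.points))} : ℝ) →
        eStar + κ ≤ Q.energyPerParticle lennardJones) →
    ∀ t : ℝ, 0 < t → ∃ κ : ℝ, 0 < κ ∧ ∀ (N : ℕ) (y : Fin N → EuclideanSpace ℝ (Fin 3)), Function.Injective y →
      t * (N : ℝ) ≤ (Nat.card {i : Fin N // ¬ GoodShell
          ((Measure.count : Measure (EuclideanSpace ℝ (Fin 3))).restrict ((fun z => z - y i) '' Set.range y))} : ℝ) →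
      (N : ℝ) * (eStar + κ) ≤ interactionEnergy lennardJones y := by
  intro hper t ht
  obtain ⟨κ, hκ, hQ⟩ := hper t ht
  refine ⟨κ, hκ, fun N y hy hbad => ?_⟩
  rcases Nat.eq_zero_or_pos N with rfl | hN
  · simp [interactionEnergy]
  · set Q := periodise y (periodUnit y) le_rfl hN with hQdef
    have hcard : Q.motif.card = N := by
      rw [hQdef, motif_periodise, Finset.card_image_of_injective _ hy, Finset.card_univ,
        Fintype.card_fin]
    have hle := natCard_bad_le_natCard_badMotif_periodise hy hN
    have hthr : t * (Q.motif.card : ℝ) ≤ (Nat.card {x : Q.motif // ¬ GoodShell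
        ((Measure.count : Measure E3).restrict ((fun z => z - (x : E3)) '' Q.points))} : ℝ) := by
      rw [hcard]
      exact hbad.trans (by exact_mod_cast hle)
    have h1 : eStar + κ ≤ Q.energyPerParticle lennardJones := hQ Q hthr
    have h2 : Q.energyPerParticle lennardJones ≤ interactionEnergy lennardJones y / N :=
      energyPerParticle_periodise_le hy (periodUnit y) le_rfl hN
    have hNr : (0 : ℝ) < N := by exact_mod_cast hN
    have h3 := h1.trans h2
    rwa [le_div_iff₀ hNr, mul_comm] at h3

end Summit.AtomisticToContinuum.Crystallization.Theorems.PalmUnimodularRigidityMinimiserShells.PeriodicShellGap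

end
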